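import Literature.NumberTheory.LFunctions.KloostermanIncompleteInterval
import HarnessLib

/-!
# Incomplete Kloosterman sums over an interval in a progression, II: general `(q, s)`

Topic `NumberTheory/LFunctions` (exponential sums).  Continuation of
`KloostermanIncompleteInterval.lean` (Bettin–Chandee, *Trilinear forms with Kloosterman
fractions*, Adv. Math. 328 (2018), Appendix, Lemma 1 (kseq) = DFI 1997 Lemma 8 with congruence and
coprimality conditions).  There the progression modulus `q` had to be coprime to the modulus `s`
of the Kloosterman fraction; the source removes this: "the case `(k, γ) > 1` can be recovered from
the case `h = (k, γ) = 1`: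
`∑_{x∈I,(x,γ)=1} e(α x̄/γ) = ∑*_{c (mod h₁), c ≡ v (mod h)} ∑_{x∈I_c,(x,γ₁)=1} e(α x̄/γ)
 = ∑*_{c} e(α (c γ₁)‾/h₁) ∑_{x ∈ I_c, (x,γ₁)=1} e(α (h₁ x)‾/γ₁) ≪ …`"
(`h₁ = (k^∞, γ)`, `γ₁ = γ/h₁`, `I_c = I ∩ {x ≡ c (mod h₁)}`), giving the factor `h₁/h` in (kseq).

This file PROVES that reduction with explicit constants, in a form parametrised by a
factorisation `s = s₁ s₂` supplied by the user (`(s₁, s₂) = 1`, `(q m₀, s₂) = 1`, `s₁ ∣ q m₀`;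
the source's choice is `s₁ = h₁`, `m₀ = h₁/h`):

* `KI_e_inv_crt` — the Chinese-remainder splitting of a Kloosterman fraction,
  `e(a x̄^{(s₁s₂)}/(s₁s₂)) = e(a (x s₂)‾^{(s₁)}/s₁) · e(a (x s₁)‾^{(s₂)}/s₂)`
  (also the device `ᾱ/(βγ) ≡ (αβ)‾/γ + (αγ)‾/β (mod 1)` of Bettin–Chandee §4.1.1);
* `KI_e_inv_mul_unit` — `e(a (x c)‾/s) = e((a c̄) x̄/s)` for `(c, s) = 1`;
* `KI_sum_subprogression_le` — along `y ≡ ρ (mod m₀)` the residue of `x = v + qy` modulo `s₁` is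
  constant, so the `s₁`-factor is a unimodular constant and `KI_sum_progression_coprime_le`
  (modulus `s₂`, progression modulus `q m₀`, frequency `a s̄₁`) applies:
  `‖∑_{y₁<y≤y₂, y≡ρ (m₀), (x,s)=1, (x,δ)=1} e(a x̄/s)‖ ≤ τ(δ)(((y₂-y₁)/m₀ + 2)/s₂ (a,s₂) + τ(s₂)√s₂ √(a,s₂)(1+log s₂))`;
* `KI_sum_progression_split_le` — summing the `m₀` classes:
  `‖∑_{y₁<y≤y₂, (x,s)=1, (x,δ)=1} e(a x̄/s)‖ ≤ m₀ τ(δ)(((y₂-y₁)/m₀ + 2)/s₂ (a,s₂) + τ(s₂)√s₂ √(a,s₂)(1+log s₂))`.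

Also the small reductions `KI_inv_val_mod_nat`, `KI_inv_val_mod_int` (inverse modulo `t` reduced
modulo `s ∣ t`), `KI_e_mod`, `KI_e_congr` (`e(a y/q)` depends on `y mod q`).

## References

* S. Bettin, V. Chandee, Adv. Math. 328 (2018) 1234–1262 (arXiv:1502.00769), Appendix, Lemma 1
  and its proof; §4.1.1 (cond:3congruence). [BettinChandee2018]
* W. Duke, J. Friedlander, H. Iwaniec, Invent. Math. 128 (1997) 23–43, Lemma 8.
  [DukeFriedlanderIwaniec1997]
-/

noncomputable section

open Finset

namespace Literature.NumberTheory.LFunctions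

open Literature.NumberTheory.Sieve.Iwaniec1978 (hooley_gcd_eq_one_iff_isUnit)

/-! ### Reduction of inverses and phases -/

/-- For `s ∣ t` and `(m, t) = 1` (`m` natural), the inverse of `m` modulo `t`, reduced modulo `s`,
is the inverse of `m` modulo `s`. [folklore] -/
theorem KI_inv_val_mod_nat {s t m : ℕ} [NeZero s] [NeZero t] (hst : s ∣ t) (hm : m.Coprime t) :
    ((m : ZMod t)⁻¹).val % s = ((m : ZMod s)⁻¹).val := by
  have hunit : IsUnit ((m : ℕ) : ZMod t) := (ZMod.isUnit_iff_coprime m t).mpr hm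
  have hcast : (ZMod.cast ((m : ZMod t)⁻¹) : ZMod s) = (ZMod.cast (m : ZMod t) : ZMod s)⁻¹ := by
    symm
    apply ZMod.inv_eq_of_mul_eq_one
    rw [← ZMod.cast_mul hst, ZMod.mul_inv_of_unit _ hunit, ZMod.cast_one hst]
  rw [ZMod.cast_eq_val, ZMod.cast_natCast hst] at hcast
  have h2 := congrArg ZMod.val hcast
  rwa [ZMod.val_natCast] at h2

/-- For `s ∣ t` and `x` an integer invertible modulo `t`, the inverse of `x` modulo `t`, reduced
modulo `s`, is the inverse of `x` modulo `s`. [folklore] -/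
theorem KI_inv_val_mod_int {s t : ℕ} [NeZero s] [NeZero t] (hst : s ∣ t) {x : ℤ}
    (hx : IsUnit (x : ZMod t)) : ((x : ZMod t)⁻¹).val % s = ((x : ZMod s)⁻¹).val := by
  have hcast : (ZMod.cast ((x : ZMod t)⁻¹) : ZMod s) = (ZMod.cast (x : ZMod t) : ZMod s)⁻¹ := by
    symm
    apply ZMod.inv_eq_of_mul_eq_one
    rw [← ZMod.cast_mul hst, ZMod.mul_inv_of_unit _ hx, ZMod.cast_one hst]
  rw [ZMod.cast_eq_val, ZMod.cast_intCast hst] at hcast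
  have h2 := congrArg ZMod.val hcast
  rwa [ZMod.val_natCast] at h2

/-- `e(a y/q) = e(a (y mod q)/q)` for natural `y`. [folklore] -/
theorem KI_e_mod (a : ℤ) {q : ℕ} (hq : 0 < q) (y : ℕ) :
    Complex.exp (2 * Real.pi * Complex.I * ((a : ℂ) * (y : ℂ) / (q : ℂ))) =
      Complex.exp (2 * Real.pi * Complex.I * ((a : ℂ) * ((y % q : ℕ) : ℂ) / (q : ℂ))) := by
  obtain ⟨t, ht⟩ : ∃ t : ℕ, y / q = t := ⟨_, rfl⟩
  obtain ⟨r, hr⟩ : ∃ r : ℕ, y % q = r := ⟨_, rfl⟩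
  have hy : y = r + q * t := by rw [← ht, ← hr]; exact (Nat.mod_add_div y q).symm
  rw [hr]
  have hdecomp : (y : ℂ) = (r : ℂ) + (q : ℂ) * (t : ℂ) := by exact_mod_cast hy
  have hq0 : (q : ℂ) ≠ 0 := by exact_mod_cast hq.ne'
  have key : 2 * (Real.pi : ℂ) * Complex.I * ((a : ℂ) * (y : ℂ) / (q : ℂ)) =
      2 * Real.pi * Complex.I * ((a : ℂ) * (r : ℂ) / (q : ℂ)) +
        ((a * t : ℤ) : ℂ) * (2 * Real.pi * Complex.I) := by
    rw [hdecomp]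
    push_cast
    field_simp
  rw [key, Complex.exp_add, Complex.exp_int_mul_two_pi_mul_I, mul_one]

/-- `e(a y/q)` only depends on `a y mod q`: if `y ≡ y' (mod q)` then `e(a y/q) = e(a y'/q)`.
[folklore] -/
theorem KI_e_congr (a : ℤ) {q : ℕ} (hq : 0 < q) {y y' : ℕ} (h : y % q = y' % q) :
    Complex.exp (2 * Real.pi * Complex.I * ((a : ℂ) * (y : ℂ) / (q : ℂ))) =
      Complex.exp (2 * Real.pi * Complex.I * ((a : ℂ) * (y' : ℂ) / (q : ℂ))) := by
  rw [KI_e_mod a hq y, KI_e_mod a hq y', h]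

/-- **Splitting the modulus of a Kloosterman fraction** (Chinese remainder theorem): for coprime
`s₁, s₂ ≥ 1` and `x` invertible modulo `s₁s₂`,
`e(a x̄^{(s₁s₂)}/(s₁s₂)) = e(a (x s₂)‾^{(s₁)}/s₁) · e(a (x s₁)‾^{(s₂)}/s₂)`. [folklore] -/
theorem KI_e_inv_crt {s₁ s₂ : ℕ} (hs₁ : 0 < s₁) (hs₂ : 0 < s₂) (hcop : s₁.Coprime s₂) (a : ℤ)
    {x : ℤ} (hx : IsUnit (x : ZMod (s₁ * s₂))) :
    Complex.exp (2 * Real.pi * Complex.I *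
        ((a : ℂ) * ((((x : ZMod (s₁ * s₂))⁻¹).val : ℕ) : ℂ) / ((s₁ * s₂ : ℕ) : ℂ))) =
      Complex.exp (2 * Real.pi * Complex.I *
          ((a : ℂ) * (((((x * s₂ : ℤ) : ZMod s₁)⁻¹).val : ℕ) : ℂ) / (s₁ : ℂ))) *
        Complex.exp (2 * Real.pi * Complex.I *
          ((a : ℂ) * (((((x * s₁ : ℤ) : ZMod s₂)⁻¹).val : ℕ) : ℂ) / (s₂ : ℂ))) := by
  haveI : NeZero s₁ := ⟨hs₁.ne'⟩
  haveI : NeZero s₂ := ⟨hs₂.ne'⟩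
  haveI : NeZero (s₁ * s₂) := ⟨(Nat.mul_pos hs₁ hs₂).ne'⟩
  have hs0 : 0 < s₁ * s₂ := Nat.mul_pos hs₁ hs₂
  -- notation
  set u : ℕ := ((x : ZMod (s₁ * s₂))⁻¹).val with hu
  set σ₁ : ℕ := ((s₂ : ZMod s₁)⁻¹).val with hσ₁
  set σ₂ : ℕ := ((s₁ : ZMod s₂)⁻¹).val with hσ₂
  -- units
  have hx₁ : IsUnit (x : ZMod s₁) := by
    have := hx.map (ZMod.castHom (dvd_mul_right s₁ s₂) (ZMod s₁))
    rwa [map_intCast] at this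
  have hx₂ : IsUnit (x : ZMod s₂) := by
    have := hx.map (ZMod.castHom (dvd_mul_left s₂ s₁) (ZMod s₂))
    rwa [map_intCast] at this
  have hu₂s₁ : IsUnit ((s₂ : ℕ) : ZMod s₁) := (ZMod.isUnit_iff_coprime s₂ s₁).mpr hcop.symm
  have hu₁s₂ : IsUnit ((s₁ : ℕ) : ZMod s₂) := (ZMod.isUnit_iff_coprime s₁ s₂).mpr hcop
  -- `σ₁ s₂ + σ₂ s₁ ≡ 1 (mod s₁ s₂)`
  have hE : (σ₁ * s₂ + σ₂ * s₁) % (s₁ * s₂) = 1 % (s₁ * s₂) := by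
    have h1 : (σ₁ * s₂ + σ₂ * s₁) ≡ 1 [MOD s₁] := by
      rw [← ZMod.natCast_eq_natCast_iff]
      push_cast
      rw [ZMod.natCast_self, mul_zero, add_zero, hσ₁, ZMod.natCast_zmod_val,
        ZMod.inv_mul_of_unit _ hu₂s₁]
    have h2 : (σ₁ * s₂ + σ₂ * s₁) ≡ 1 [MOD s₂] := by
      rw [← ZMod.natCast_eq_natCast_iff]
      push_cast
      rw [ZMod.natCast_self, mul_zero, zero_add, hσ₂, ZMod.natCast_zmod_val,
        ZMod.inv_mul_of_unit _ hu₁s₂]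
    exact (Nat.modEq_and_modEq_iff_modEq_mul hcop).mp ⟨h1, h2⟩
  -- Step 1: `e(a u/s) = e(a u (σ₁ s₂ + σ₂ s₁)/s)`
  have hstep1 : Complex.exp (2 * Real.pi * Complex.I *
        ((a : ℂ) * (u : ℂ) / ((s₁ * s₂ : ℕ) : ℂ))) =
      Complex.exp (2 * Real.pi * Complex.I *
        ((a : ℂ) * ((u * (σ₁ * s₂ + σ₂ * s₁) : ℕ) : ℂ) / ((s₁ * s₂ : ℕ) : ℂ))) := by
    refine KI_e_congr a hs0 ?_
    conv_lhs => rw [← mul_one u]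
    exact (Nat.ModEq.mul_left u hE).symm
  -- Step 2: `= e(a u σ₁/s₁) e(a u σ₂/s₂)`
  have hstep2 : Complex.exp (2 * Real.pi * Complex.I *
        ((a : ℂ) * ((u * (σ₁ * s₂ + σ₂ * s₁) : ℕ) : ℂ) / ((s₁ * s₂ : ℕ) : ℂ))) =
      Complex.exp (2 * Real.pi * Complex.I * ((a : ℂ) * ((u * σ₁ : ℕ) : ℂ) / (s₁ : ℂ))) *
        Complex.exp (2 * Real.pi * Complex.I * ((a : ℂ) * ((u * σ₂ : ℕ) : ℂ) / (s₂ : ℂ))) := by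
    rw [← Complex.exp_add]
    congr 1
    have h1 : (s₁ : ℂ) ≠ 0 := by exact_mod_cast hs₁.ne'
    have h2 : (s₂ : ℂ) ≠ 0 := by exact_mod_cast hs₂.ne'
    push_cast
    field_simp
  -- Step 3: identify `u σ₁ mod s₁` and `u σ₂ mod s₂` with the inverses of `x s₂`, `x s₁`
  have hid₁ : (u * σ₁) % s₁ = (((x * s₂ : ℤ) : ZMod s₁)⁻¹).val := by
    have hum : u % s₁ = ((x : ZMod s₁)⁻¹).val := KI_inv_val_mod_int (dvd_mul_right s₁ s₂) hx
    have hinv : ((x * s₂ : ℤ) : ZMod s₁)⁻¹ = (x : ZMod s₁)⁻¹ * ((s₂ : ℕ) : ZMod s₁)⁻¹ := by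
      apply ZMod.inv_eq_of_mul_eq_one
      push_cast
      calc (x : ZMod s₁) * (s₂ : ZMod s₁) * ((x : ZMod s₁)⁻¹ * ((s₂ : ℕ) : ZMod s₁)⁻¹)
          = ((x : ZMod s₁) * (x : ZMod s₁)⁻¹) * (((s₂ : ℕ) : ZMod s₁) * ((s₂ : ℕ) : ZMod s₁)⁻¹) := by
            ring
        _ = 1 := by rw [ZMod.mul_inv_of_unit _ hx₁, ZMod.mul_inv_of_unit _ hu₂s₁, one_mul]
    have hcastu : ((u * σ₁ : ℕ) : ZMod s₁) = ((x * s₂ : ℤ) : ZMod s₁)⁻¹ := by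
      rw [hinv, Nat.cast_mul, ← ZMod.natCast_mod u s₁, hum, ZMod.natCast_zmod_val, hσ₁,
        ZMod.natCast_zmod_val]
    have := congrArg ZMod.val hcastu
    rwa [ZMod.val_natCast] at this
  have hid₂ : (u * σ₂) % s₂ = (((x * s₁ : ℤ) : ZMod s₂)⁻¹).val := by
    have hum : u % s₂ = ((x : ZMod s₂)⁻¹).val := KI_inv_val_mod_int (dvd_mul_left s₂ s₁) hx
    have hinv : ((x * s₁ : ℤ) : ZMod s₂)⁻¹ = (x : ZMod s₂)⁻¹ * ((s₁ : ℕ) : ZMod s₂)⁻¹ := by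
      apply ZMod.inv_eq_of_mul_eq_one
      push_cast
      calc (x : ZMod s₂) * (s₁ : ZMod s₂) * ((x : ZMod s₂)⁻¹ * ((s₁ : ℕ) : ZMod s₂)⁻¹)
          = ((x : ZMod s₂) * (x : ZMod s₂)⁻¹) * (((s₁ : ℕ) : ZMod s₂) * ((s₁ : ℕ) : ZMod s₂)⁻¹) := by
            ring
        _ = 1 := by rw [ZMod.mul_inv_of_unit _ hx₂, ZMod.mul_inv_of_unit _ hu₁s₂, one_mul]
    have hcastu : ((u * σ₂ : ℕ) : ZMod s₂) = ((x * s₁ : ℤ) : ZMod s₂)⁻¹ := by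
      rw [hinv, Nat.cast_mul, ← ZMod.natCast_mod u s₂, hum, ZMod.natCast_zmod_val, hσ₂,
        ZMod.natCast_zmod_val]
    have := congrArg ZMod.val hcastu
    rwa [ZMod.val_natCast] at this
  rw [hstep1, hstep2, KI_e_mod a hs₁ (u * σ₁), KI_e_mod a hs₂ (u * σ₂), hid₁, hid₂]


/-- Pulling a unit factor out of a Kloosterman fraction: for `(c, s) = 1` with `σ = c̄^{(s)}` and
`x` invertible modulo `s`, `e(a (x c)‾/s) = e((a σ) x̄/s)`. [folklore] -/
theorem KI_e_inv_mul_unit {s : ℕ} (hs : 0 < s) (a : ℤ) {c : ℕ} (hc : c.Coprime s) {x : ℤ}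
    (hx : IsUnit (x : ZMod s)) :
    Complex.exp (2 * Real.pi * Complex.I *
        ((a : ℂ) * (((((x * c : ℤ) : ZMod s)⁻¹).val : ℕ) : ℂ) / (s : ℂ))) =
      Complex.exp (2 * Real.pi * Complex.I *
        (((a * (((c : ZMod s)⁻¹).val : ℕ) : ℤ) : ℂ) * ((((x : ZMod s)⁻¹).val : ℕ) : ℂ) /
          (s : ℂ))) := by
  haveI : NeZero s := ⟨hs.ne'⟩
  have hcu : IsUnit ((c : ℕ) : ZMod s) := (ZMod.isUnit_iff_coprime c s).mpr hc
  set σ : ℕ := ((c : ZMod s)⁻¹).val with hσ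
  have hinv : ((x * c : ℤ) : ZMod s)⁻¹ = (x : ZMod s)⁻¹ * ((c : ℕ) : ZMod s)⁻¹ := by
    apply ZMod.inv_eq_of_mul_eq_one
    push_cast
    calc (x : ZMod s) * (c : ZMod s) * ((x : ZMod s)⁻¹ * ((c : ℕ) : ZMod s)⁻¹)
        = ((x : ZMod s) * (x : ZMod s)⁻¹) * (((c : ℕ) : ZMod s) * ((c : ℕ) : ZMod s)⁻¹) := by
          ring
      _ = 1 := by rw [ZMod.mul_inv_of_unit _ hx, ZMod.mul_inv_of_unit _ hcu, one_mul]
  have hmod : (((x * c : ℤ) : ZMod s)⁻¹).val % s = (((x : ZMod s)⁻¹).val * σ) % s := by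
    have hcast : ((((x : ZMod s)⁻¹).val * σ : ℕ) : ZMod s) = ((x * c : ℤ) : ZMod s)⁻¹ := by
      rw [hinv, Nat.cast_mul, ZMod.natCast_zmod_val, hσ, ZMod.natCast_zmod_val]
    have := congrArg ZMod.val hcast
    rw [ZMod.val_natCast] at this
    rw [this]
    exact Nat.mod_eq_of_lt (ZMod.val_lt (((x * c : ℤ) : ZMod s)⁻¹))
  rw [KI_e_congr a hs hmod]
  congr 1
  push_cast
  ring

/-! ### The case `(q, s) > 1`: sub-progressions along which `x mod s₁` is constant -/

/-- **One sub-progression.**  Let `s = s₁ s₂` with `(s₁, s₂) = 1`, `m₀ ≥ 1` with `s₁ ∣ q m₀` and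
`(q m₀, s₂) = 1`, `δ ≥ 1` with `(δ, q m₀) = 1`.  Along `y ≡ ρ (mod m₀)` the residue of
`x = v + qy` modulo `s₁` is constant, `e(a x̄/s) = e(a (x s₂)‾/s₁) e(a (x s₁)‾/s₂)` splits off a
constant unimodular factor, and `KI_sum_progression_coprime_le` (modulus `s₂`, progression modulus
`q m₀`) bounds the rest:
`‖∑_{y₁<y≤y₂, y≡ρ (m₀), (x,s)=1, (x,δ)=1} e(a x̄/s)‖ ≤ τ(δ) ( ((y₂-y₁)/m₀ + 2)/s₂ (a,s₂) + τ(s₂) √s₂ √(a,s₂) (1+log s₂) )`.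
(Bettin–Chandee, Appendix Lemma 1: "the case `(k,γ) > 1` can be recovered from the case
`h = (k,γ) = 1`" by splitting into classes modulo `h₁ = (k^∞, γ)`.)
[cite: BettinChandee2018, Appendix Lemma 1] -/
theorem KI_sum_subprogression_le {s s₁ s₂ : ℕ} (hs : s = s₁ * s₂) (hs₁ : 0 < s₁)
    (hs₂ : 0 < s₂) (hcop : s₁.Coprime s₂) {q m₀ : ℕ} (hm₀ : 0 < m₀)
    (hqm : (q * m₀).Coprime s₂) (hdiv : s₁ ∣ q * m₀) {δ : ℕ} (hδ : 0 < δ)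
    (hδq : δ.Coprime (q * m₀)) (a v y₁ y₂ ρ : ℤ) (hy : y₁ ≤ y₂) :
    ‖∑ y ∈ (Finset.Ioc y₁ y₂).filter (fun y : ℤ =>
        (Int.gcd (v + q * y) s = 1 ∧ Int.gcd (v + q * y) δ = 1) ∧ y ≡ ρ [ZMOD m₀]),
        Complex.exp (2 * Real.pi * Complex.I *
          ((a : ℂ) * (((((v + q * y : ℤ) : ZMod s)⁻¹).val : ℕ) : ℂ) / (s : ℂ)))‖ ≤
      (Nat.divisors δ).card *
        (((((y₂ - y₁ : ℤ) : ℝ)) / m₀ + 2) / s₂ * Int.gcd a s₂ +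
          (Nat.divisors s₂).card * Real.sqrt s₂ * Real.sqrt (Int.gcd a s₂) *
            (1 + Real.log s₂)) := by
  classical
  subst hs
  haveI : NeZero s₁ := ⟨hs₁.ne'⟩
  haveI : NeZero s₂ := ⟨hs₂.ne'⟩
  haveI : NeZero (s₁ * s₂) := ⟨(Nat.mul_pos hs₁ hs₂).ne'⟩
  have hs0 : 0 < s₁ * s₂ := Nat.mul_pos hs₁ hs₂
  have hs₂r : (0 : ℝ) < s₂ := by exact_mod_cast hs₂
  have hm₀r : (0 : ℝ) < m₀ := by exact_mod_cast hm₀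
  -- notation
  set F : ℤ → ℂ := fun x => Complex.exp (2 * Real.pi * Complex.I *
      ((a : ℂ) * ((((x : ZMod (s₁ * s₂))⁻¹).val : ℕ) : ℂ) / ((s₁ * s₂ : ℕ) : ℂ))) with hF
  set W : ℝ := (Nat.divisors s₂).card * Real.sqrt s₂ * Real.sqrt (Int.gcd a s₂) *
    (1 + Real.log s₂) with hW
  have hlog : 0 ≤ 1 + Real.log s₂ := by
    have := Real.log_nonneg (show (1 : ℝ) ≤ s₂ by exact_mod_cast hs₂); linarith
  have hW0 : 0 ≤ W := by rw [hW]; positivity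
  have hy0 : (0 : ℝ) ≤ ((y₂ - y₁ : ℤ) : ℝ) := by exact_mod_cast (sub_nonneg.mpr hy)
  set Bd : ℝ := (Nat.divisors δ).card *
    (((((y₂ - y₁ : ℤ) : ℝ)) / m₀ + 2) / s₂ * Int.gcd a s₂ + W) with hBd
  have hBd0 : 0 ≤ Bd := by rw [hBd]; positivity
  have hF' : ∀ y : ℤ, Complex.exp (2 * Real.pi * Complex.I *
      ((a : ℂ) * (((((v + q * y : ℤ) : ZMod (s₁ * s₂))⁻¹).val : ℕ) : ℂ) /
        ((s₁ * s₂ : ℕ) : ℂ))) = F (v + q * y) := fun y => rfl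
  simp_rw [hF']
  -- Step 1: reparametrise `y = z m₀ + ρ`
  have hm₀' : (0 : ℤ) < m₀ := by exact_mod_cast hm₀
  have hset : (Finset.Ioc y₁ y₂).filter (fun y : ℤ =>
        (Int.gcd (v + q * y) ((s₁ * s₂ : ℕ) : ℤ) = 1 ∧ Int.gcd (v + q * y) δ = 1) ∧ y ≡ ρ [ZMOD m₀]) =
      ((((Finset.Ioc (y₁ - ρ) (y₂ - ρ)).filter (fun y : ℤ => (m₀ : ℤ) ∣ y)).map
          ⟨(· + ρ), add_left_injective ρ⟩).filter
        (fun y : ℤ => Int.gcd (v + q * y) ((s₁ * s₂ : ℕ) : ℤ) = 1 ∧ Int.gcd (v + q * y) δ = 1)) := by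
    rw [← Int.Ioc_filter_modEq_eq, Finset.filter_filter]
    exact Finset.filter_congr fun y _ => and_comm
  rw [hset, Int.Ioc_filter_dvd_eq _ _ hm₀', Finset.map_map, Finset.sum_filter, Finset.sum_map]
  simp only [Function.Embedding.trans_apply, Function.Embedding.coeFn_mk]
  rw [← Finset.sum_filter]
  set z₁ : ℤ := ⌊((y₁ - ρ : ℤ) : ℚ) / (m₀ : ℤ)⌋ with hz₁
  set z₂ : ℤ := ⌊((y₂ - ρ : ℤ) : ℚ) / (m₀ : ℤ)⌋ with hz₂
  have hz : z₁ ≤ z₂ := by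
    rw [hz₁, hz₂]
    refine Int.floor_le_floor (div_le_div_of_nonneg_right ?_ (by exact_mod_cast hm₀.le))
    exact_mod_cast (show y₁ - ρ ≤ y₂ - ρ by linarith)
  have hz' : ((z₂ - z₁ : ℤ) : ℝ) ≤ ((y₂ - y₁ : ℤ) : ℝ) / m₀ + 1 := by
    have h1 : ((z₂ : ℤ) : ℚ) ≤ ((y₂ - ρ : ℤ) : ℚ) / (m₀ : ℤ) := by rw [hz₂]; exact Int.floor_le _
    have h2 : ((y₁ - ρ : ℤ) : ℚ) / (m₀ : ℤ) < ((z₁ : ℤ) : ℚ) + 1 := by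
      rw [hz₁]; exact Int.lt_floor_add_one _
    have hmq : (0 : ℚ) < (m₀ : ℤ) := by exact_mod_cast hm₀'
    have h3 : ((z₂ - z₁ : ℤ) : ℚ) ≤ ((y₂ - y₁ : ℤ) : ℚ) / (m₀ : ℤ) + 1 := by
      have h4 : ((y₂ - ρ : ℤ) : ℚ) / (m₀ : ℤ) - ((y₁ - ρ : ℤ) : ℚ) / (m₀ : ℤ) =
          ((y₂ - y₁ : ℤ) : ℚ) / (m₀ : ℤ) := by push_cast; ring
      push_cast at h1 h2 h4 ⊢
      linarith
    have h6 : (((z₂ - z₁ : ℤ) : ℚ) : ℝ) ≤ ((((y₂ - y₁ : ℤ) : ℚ) / (m₀ : ℤ) + 1 : ℚ) : ℝ) := by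
      exact_mod_cast h3
    push_cast at h6 ⊢
    exact h6
  -- the new progression `x = v' + q' z`, `q' = q m₀`
  set v' : ℤ := v + q * ρ with hv'
  have hlin : ∀ z : ℤ, v + q * (z * m₀ + ρ) = v' + ((q * m₀ : ℕ) : ℤ) * z := by
    intro z; rw [hv']; push_cast; ring
  have hsum : ∑ z ∈ (Finset.Ioc z₁ z₂).filter (fun z : ℤ =>
        Int.gcd (v + q * (z * m₀ + ρ)) ((s₁ * s₂ : ℕ) : ℤ) = 1 ∧ Int.gcd (v + q * (z * m₀ + ρ)) δ = 1),
        F (v + q * (z * m₀ + ρ)) =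
      ∑ z ∈ (Finset.Ioc z₁ z₂).filter (fun z : ℤ =>
        Int.gcd (v' + ((q * m₀ : ℕ) : ℤ) * z) ((s₁ * s₂ : ℕ) : ℤ) = 1 ∧
          Int.gcd (v' + ((q * m₀ : ℕ) : ℤ) * z) δ = 1), F (v' + ((q * m₀ : ℕ) : ℤ) * z) := by
    rw [Finset.filter_congr (fun z _ => by rw [hlin z])]
    exact Finset.sum_congr rfl fun z _ => by rw [hlin z]
  rw [hsum]
  -- `x ≡ v' (mod s₁)` along the progression
  have hcong : ∀ z : ℤ, ((v' + ((q * m₀ : ℕ) : ℤ) * z : ℤ) : ZMod s₁) = (v' : ZMod s₁) := by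
    intro z
    obtain ⟨t, ht⟩ := hdiv
    push_cast
    rw [show ((q : ZMod s₁)) * (m₀ : ZMod s₁) = ((q * m₀ : ℕ) : ZMod s₁) by push_cast; ring, ht]
    push_cast
    rw [ZMod.natCast_self, zero_mul, zero_mul, add_zero]
  by_cases hv's₁ : IsUnit (v' : ZMod s₁)
  · -- Step 2: the conditions reduce to those modulo `s₂` and `δ`
    have hfilt : (Finset.Ioc z₁ z₂).filter (fun z : ℤ =>
          Int.gcd (v' + ((q * m₀ : ℕ) : ℤ) * z) ((s₁ * s₂ : ℕ) : ℤ) = 1 ∧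
            Int.gcd (v' + ((q * m₀ : ℕ) : ℤ) * z) δ = 1) =
        (Finset.Ioc z₁ z₂).filter (fun z : ℤ =>
          Int.gcd (v' + ((q * m₀ : ℕ) : ℤ) * z) s₂ = 1 ∧
            Int.gcd (v' + ((q * m₀ : ℕ) : ℤ) * z) δ = 1) := by
      refine Finset.filter_congr fun z _ => ?_
      have hiff : Int.gcd (v' + ((q * m₀ : ℕ) : ℤ) * z) ((s₁ * s₂ : ℕ) : ℤ) = 1 ↔
          Int.gcd (v' + ((q * m₀ : ℕ) : ℤ) * z) s₂ = 1 := by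
        rw [← Int.isCoprime_iff_gcd_eq_one, ← Int.isCoprime_iff_gcd_eq_one, Nat.cast_mul s₁ s₂,
          IsCoprime.mul_right_iff]
        constructor
        · exact fun h => h.2
        · intro h
          refine ⟨?_, h⟩
          rw [Int.isCoprime_iff_gcd_eq_one, hooley_gcd_eq_one_iff_isUnit, hcong z]
          exact hv's₁
      rw [hiff]
    rw [hfilt]
    -- Step 3: split the phase; the first factor is constant, the second has frequency `a σ₂`
    set σ₂ : ℕ := ((s₁ : ZMod s₂)⁻¹).val with hσ₂
    set a' : ℤ := a * (σ₂ : ℤ) with ha'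
    set C₀ : ℂ := Complex.exp (2 * Real.pi * Complex.I *
      ((a : ℂ) * (((((v' * s₂ : ℤ) : ZMod s₁)⁻¹).val : ℕ) : ℂ) / (s₁ : ℂ))) with hC₀
    have hC₀n : ‖C₀‖ = 1 := by
      have h : 2 * (Real.pi : ℂ) * Complex.I *
          ((a : ℂ) * (((((v' * s₂ : ℤ) : ZMod s₁)⁻¹).val : ℕ) : ℂ) / (s₁ : ℂ)) =
          (((2 * Real.pi * ((a : ℝ) * (((((v' * s₂ : ℤ) : ZMod s₁)⁻¹).val : ℕ) : ℝ) /
            (s₁ : ℝ)) : ℝ)) : ℂ) * Complex.I := by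
        push_cast; ring
      rw [hC₀, h, Complex.norm_exp_ofReal_mul_I]
    have hterm : ∀ z ∈ (Finset.Ioc z₁ z₂).filter (fun z : ℤ =>
          Int.gcd (v' + ((q * m₀ : ℕ) : ℤ) * z) s₂ = 1 ∧
            Int.gcd (v' + ((q * m₀ : ℕ) : ℤ) * z) δ = 1),
        F (v' + ((q * m₀ : ℕ) : ℤ) * z) =
          C₀ * Complex.exp (2 * Real.pi * Complex.I *
            ((a' : ℂ) * (((((v' + ((q * m₀ : ℕ) : ℤ) * z : ℤ) : ZMod s₂)⁻¹).val : ℕ) : ℂ) /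
              (s₂ : ℂ))) := by
      intro z hz0
      have hz2 := (Finset.mem_filter.mp hz0).2.1
      set x : ℤ := v' + ((q * m₀ : ℕ) : ℤ) * z with hx
      have hxu₂ : IsUnit (x : ZMod s₂) := (hooley_gcd_eq_one_iff_isUnit _).mp hz2
      have hxu₁ : IsUnit (x : ZMod s₁) := by rw [hx, hcong z]; exact hv's₁
      have hxu : IsUnit (x : ZMod (s₁ * s₂)) := by
        rw [← hooley_gcd_eq_one_iff_isUnit, ← Int.isCoprime_iff_gcd_eq_one]
        push_cast
        rw [IsCoprime.mul_right_iff, Int.isCoprime_iff_gcd_eq_one, Int.isCoprime_iff_gcd_eq_one,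
          hooley_gcd_eq_one_iff_isUnit, hooley_gcd_eq_one_iff_isUnit]
        exact ⟨hxu₁, hxu₂⟩
      simp only [hF]
      rw [KI_e_inv_crt hs₁ hs₂ hcop a hxu]
      congr 1
      · -- the factor modulo `s₁` only depends on `x ≡ v' (mod s₁)`
        rw [hC₀]
        have : ((x * s₂ : ℤ) : ZMod s₁) = ((v' * s₂ : ℤ) : ZMod s₁) := by
          push_cast; rw [hx, hcong z]
        rw [this]
      · rw [KI_e_inv_mul_unit hs₂ a hcop hxu₂]
    rw [Finset.sum_congr rfl hterm, ← Finset.mul_sum, norm_mul, hC₀n, one_mul]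
    -- Step 4: `KI_sum_progression_coprime_le` with modulus `s₂`, frequency `a'`
    have key := KI_sum_progression_coprime_le hs₂ hqm hδ hδq a' v' z₁ z₂ hz
    refine key.trans ?_
    -- `(a', s₂) = (a, s₂)`
    have hσu : σ₂.Coprime s₂ := by
      have hu : IsUnit ((s₁ : ℕ) : ZMod s₂) := (ZMod.isUnit_iff_coprime s₁ s₂).mpr hcop
      obtain ⟨u, hu'⟩ := hu
      have h1 : ((s₁ : ZMod s₂))⁻¹ = ((u⁻¹ : (ZMod s₂)ˣ) : ZMod s₂) := by
        rw [← hu', ZMod.inv_coe_unit]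
      rw [hσ₂, h1]
      exact ZMod.val_coe_unit_coprime _
    have hgcd : Int.gcd a' s₂ = Int.gcd a s₂ := by
      rw [ha', Int.gcd_eq_natAbs, Int.gcd_eq_natAbs, Int.natAbs_mul, Int.natAbs_natCast,
        Int.natAbs_natCast]
      exact Nat.Coprime.gcd_mul_right_cancel _ hσu
    rw [hgcd, hBd, hW]
    have hτ0 : (0 : ℝ) ≤ (Nat.divisors δ).card := Nat.cast_nonneg _
    refine mul_le_mul_of_nonneg_left ?_ hτ0
    have hlen : (((z₂ - z₁ : ℤ) : ℝ) + 1) / s₂ * Int.gcd a s₂ ≤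
        ((((y₂ - y₁ : ℤ) : ℝ)) / m₀ + 2) / s₂ * Int.gcd a s₂ := by
      have : ((z₂ - z₁ : ℤ) : ℝ) + 1 ≤ ((y₂ - y₁ : ℤ) : ℝ) / m₀ + 2 := by linarith
      gcongr
    linarith
  · -- `(v', s₁) > 1`: every term violates `(x, s₁ s₂) = 1`
    have hempty : (Finset.Ioc z₁ z₂).filter (fun z : ℤ =>
        Int.gcd (v' + ((q * m₀ : ℕ) : ℤ) * z) ((s₁ * s₂ : ℕ) : ℤ) = 1 ∧
          Int.gcd (v' + ((q * m₀ : ℕ) : ℤ) * z) δ = 1) = ∅ := by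
      refine Finset.filter_false_of_mem fun z _ => ?_
      rintro ⟨h1, -⟩
      apply hv's₁
      rw [← Int.isCoprime_iff_gcd_eq_one, Nat.cast_mul s₁ s₂] at h1
      have h2 := (IsCoprime.mul_right_iff.mp h1).1
      rw [Int.isCoprime_iff_gcd_eq_one, hooley_gcd_eq_one_iff_isUnit, hcong z] at h2
      exact h2
    rw [hempty, Finset.sum_empty, norm_zero]
    exact hBd0

/-- **Incomplete Kloosterman sums over an interval in a progression, general `(q, s)`**
(Bettin–Chandee, Appendix Lemma 1 (kseq): the factor `h₁/h`).  Let `s = s₁ s₂` with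
`(s₁, s₂) = 1`, `m₀ ≥ 1` with `s₁ ∣ q m₀` and `(q m₀, s₂) = 1` (e.g. `s₁ = (q^∞, s)`,
`m₀ = s₁/(q, s)`), and `δ ≥ 1` with `(δ, q m₀) = 1`.  Then for integers `a, v` and `y₁ ≤ y₂`,
`‖∑_{y₁<y≤y₂, (v+qy, s)=1, (v+qy, δ)=1} e(a (v+qy)‾/s)‖`
`≤ m₀ τ(δ) ( ((y₂-y₁)/m₀ + 2)/s₂ (a, s₂) + τ(s₂) √s₂ √(a, s₂) (1 + log s₂) )`
(split `y` into the `m₀` classes modulo `m₀` and apply `KI_sum_subprogression_le`).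
[cite: BettinChandee2018, Appendix Lemma 1] -/
theorem KI_sum_progression_split_le {s s₁ s₂ : ℕ} (hs : s = s₁ * s₂) (hs₁ : 0 < s₁)
    (hs₂ : 0 < s₂) (hcop : s₁.Coprime s₂) {q m₀ : ℕ} (hm₀ : 0 < m₀)
    (hqm : (q * m₀).Coprime s₂) (hdiv : s₁ ∣ q * m₀) {δ : ℕ} (hδ : 0 < δ)
    (hδq : δ.Coprime (q * m₀)) (a v y₁ y₂ : ℤ) (hy : y₁ ≤ y₂) :
    ‖∑ y ∈ (Finset.Ioc y₁ y₂).filter (fun y : ℤ =>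
        Int.gcd (v + q * y) s = 1 ∧ Int.gcd (v + q * y) δ = 1),
        Complex.exp (2 * Real.pi * Complex.I *
          ((a : ℂ) * (((((v + q * y : ℤ) : ZMod s)⁻¹).val : ℕ) : ℂ) / (s : ℂ)))‖ ≤
      m₀ * ((Nat.divisors δ).card *
        (((((y₂ - y₁ : ℤ) : ℝ)) / m₀ + 2) / s₂ * Int.gcd a s₂ +
          (Nat.divisors s₂).card * Real.sqrt s₂ * Real.sqrt (Int.gcd a s₂) *
            (1 + Real.log s₂))) := by
  classical
  set A := (Finset.Ioc y₁ y₂).filter (fun y : ℤ =>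
    Int.gcd (v + q * y) s = 1 ∧ Int.gcd (v + q * y) δ = 1) with hA
  set f : ℤ → ℂ := fun y => Complex.exp (2 * Real.pi * Complex.I *
    ((a : ℂ) * (((((v + q * y : ℤ) : ZMod s)⁻¹).val : ℕ) : ℂ) / (s : ℂ))) with hf
  set Bd : ℝ := (Nat.divisors δ).card *
    (((((y₂ - y₁ : ℤ) : ℝ)) / m₀ + 2) / s₂ * Int.gcd a s₂ +
      (Nat.divisors s₂).card * Real.sqrt s₂ * Real.sqrt (Int.gcd a s₂) *
        (1 + Real.log s₂)) with hBd
  have hm₀' : (0 : ℤ) < m₀ := by exact_mod_cast hm₀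
  -- partition by `y mod m₀`
  set g : ℤ → ℕ := fun y => (y % (m₀ : ℤ)).toNat with hg
  have hmaps : ∀ y ∈ A, g y ∈ Finset.range m₀ := by
    intro y _
    rw [Finset.mem_range]
    have h1 : 0 ≤ y % (m₀ : ℤ) := Int.emod_nonneg _ hm₀'.ne'
    have h2 : y % (m₀ : ℤ) < m₀ := Int.emod_lt_of_pos _ hm₀'
    simp only [hg]
    omega
  have hpart := Finset.sum_fiberwise_of_maps_to (s := A) (t := Finset.range m₀) (g := g) hmaps
    (f := f)
  show ‖∑ y ∈ A, f y‖ ≤ m₀ * Bd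
  rw [← hpart]
  have hfib : ∀ r ∈ Finset.range m₀, ‖∑ y ∈ A.filter (fun y => g y = r), f y‖ ≤ Bd := by
    intro r hr
    rw [Finset.mem_range] at hr
    have hfilt : A.filter (fun y => g y = r) = (Finset.Ioc y₁ y₂).filter (fun y : ℤ =>
        (Int.gcd (v + q * y) s = 1 ∧ Int.gcd (v + q * y) δ = 1) ∧
          y ≡ (r : ℤ) [ZMOD m₀]) := by
      rw [hA, Finset.filter_filter]
      refine Finset.filter_congr fun y _ => ?_
      have h1 : 0 ≤ y % (m₀ : ℤ) := Int.emod_nonneg _ hm₀'.ne'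
      have hiff : g y = r ↔ y ≡ (r : ℤ) [ZMOD m₀] := by
        simp only [hg]
        rw [Int.ModEq, Int.emod_eq_of_lt (by positivity : (0 : ℤ) ≤ r)
          (by exact_mod_cast hr : (r : ℤ) < m₀)]
        omega
      rw [hiff]
    rw [hfilt]
    exact KI_sum_subprogression_le hs hs₁ hs₂ hcop hm₀ hqm hdiv hδ hδq a v y₁ y₂ r hy
  calc ‖∑ r ∈ Finset.range m₀, ∑ y ∈ A.filter (fun y => g y = r), f y‖
      ≤ ∑ r ∈ Finset.range m₀, ‖∑ y ∈ A.filter (fun y => g y = r), f y‖ := norm_sum_le _ _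
    _ ≤ ∑ r ∈ Finset.range m₀, Bd := Finset.sum_le_sum hfib
    _ = m₀ * Bd := by rw [Finset.sum_const, Finset.card_range, nsmul_eq_mul]

end Literature.NumberTheory.LFunctions

end
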